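import Literature.MathematicalPhysics.QuantumFieldTheory.Balaban1983to89.Beta.LogDetHessian
import Literature.MathematicalPhysics.QuantumFieldTheory.Balaban1983to89.Beta.CompositionSingular

/-!
# `BalabanUV.Beta.LogZFirstJet` — binder row D1, route (O3), work item K-U4: **THE FIRST JET («TADPOLE FORMULA») OF THE ONE-LOOP
# FUNCTIONAL `Family.logZ`** — `∂ᵢ log Z(0) = −½·tr(K₀⁻¹ ∂ᵢK) = −½·tr(𝒢·∂ᵢΔ) − ½·tr(ℋ·∂ᵢQ̃) − ½·tr(ℋ♭·∂ᵢQ̃ᵀ)`, and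
# **TADPOLE-FREENESS ⟺ EVERY SINGLE-INSERTION CONTRACTION VANISHES**; the parity mechanism `tr(G S) = 0` in matrix currency
# (β sub-cell, BINDER-OWNERS row D1 OWNER, lineage an2 gen 24; the MATRIX half of the bridge asked for by d1-formalise-ref FINDING F-d1ref28-1)

HONEST FRAMING (cell charter, verbatim): «discharging BetaPertH makes Balaban's UV stability UNCONDITIONAL — a real
constructive-QFT result; it is NOT the continuum limit and NOT the Clay problem.»
HONEST DEPENDENCY: continuum YM on T⁴ ⇐ BetaPertH ∧ nine spine estimates (0/9 proved); BetaPertH ⇐ (D1) ∧ (D4) ∧ CAP+tail;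
G-an2-4 gates asym, D1 and NE2/3/4.
ABSOLUTE RULE (cell, verbatim): «No internally-minted statement may enter as a cited fact. Every hypothesis is either kernel-proved in this
package or a verbatim quotation of a PUBLISHED theorem with page reference. The manuscript(s) under audit are NOT citable for their own
disputed steps — they are the thing under adjudication; programme-internal (2001/route/tribunal) claims are never citable.»
NOTHING below is cited: no `[cite: …]`, no `def`, no `Prop` fact.  Every declaration is [folklore] finite-dimensional calculus ∕ linear algebra over
pv09∕an2's `LogDetHessian` (Part 1 `hasFDerivAt_log_det`, `fderiv_apply_entry`, `contDiffAt_matrix` — scoped `L^∞` operator norm, appearing in NO exported `Family` statement; Part 2 `trace_blockInv_mul_variation`; Part 3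
`Family.dK ∕ dΔ ∕ dQ`, `dK_eq_fromBlocks`) and an2's `CompositionSingular` (`flucCov ∕ minOp ∕ minOpL ∕ effForm`, `kktInv_eq_fromBlocks`,
`minOpL_eq_transpose`) BY NAME.  It asserts nothing about Bałaban's objects.

WHY (row-D1 owner, gen 24).  d1-formalise-ref REFEREE #28 FINDING F-d1ref28-1 (journal l.22280; GAPS C-d1ref28-1): the binder consumed by K-U2
`stepDefect_eq_zero_of_tadpoleFree`, K-U2b∕K-U2c `…_of_tadpoleFree` and K-U2e's END is the FUNCTIONAL-level first jet `fderiv ℝ (Family.logZ F₁) 0 = 0`,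
while the literal's parity theorems (`SpineRecursiveParity.trK_SrecAt`, `KernelWardRelativeEnd.tadpole_eq_zero_of_parity`, …) conclude
`ExpKernelCalculus.tadpole K S = 0` in KERNEL-CALCULUS currency, and no tree theorem bridges the two.  The bridge has two halves: (a) the first jet of
the finite-volume log-det functional IS a single-insertion trace — THIS FILE, one derivative below `LogDetHessian.Family.polarization_eq_trace`; (b) on the
torus, the literal's `tadpole K S` is that trace for the periodised family, and `T ↗ ℤ⁴` (ROUTE-O3 W-4 proper; road BF-x bricks) — NOT here.

WHAT (all [folklore]; `E` a real normed space, `p` a finite index type, `F : Family ι n m`):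
§1 `fderiv_log_det_apply` (`D(log det K)(x₀)[u] = tr(K₀⁻¹·DK(x₀)u)` along a differentiable matrix field), `fderiv_log_det_entrywise` (entrywise data).
§2 **`fderiv_logZ_apply`** (`D(F.logZ)(0)[u] = −½·tr(K₀⁻¹·∂_uK)`, entrywise `C¹` data, `det K₀ ≠ 0`), **`fderiv_logZ_single`** (`u = eᵢ`: `−½·tr(K₀⁻¹·F.dK i)`),
   **`fderiv_logZ_single_blocks`** (`= −½·tr(flucCov·∂ᵢΔ) − ½·tr(minOp·∂ᵢQ̃) − ½·tr(minOpL·∂ᵢQ̃ᵀ)`), **`fderiv_logZ_single_blocks_of_symm`** (symmetric `Δ(0)`: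
   `= −½·tr(flucCov·∂ᵢΔ) − tr(minOp·∂ᵢQ̃)`).
§3 **`fderiv_logZ_eq_zero_iff`** (TADPOLE-FREENESS ⟺ `∀ i, tr(K₀⁻¹·∂ᵢK) = 0`), **`fderiv_logZ_eq_zero_iff_of_constQ`** (background-independent constraint:
   ⟺ `∀ i, tr(flucCov(0)·∂ᵢΔ) = 0` — «every single-insertion contraction of the first vertex against the fluctuation covariance vanishes»).
§4 **`trace_mul_eq_zero_of_parity`** (`PGP = G`, `PSP = −S` ⟹ `tr(GS) = 0` — the matrix shape of the literal's J-signed parity mechanism),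
   **`fderiv_logZ_eq_zero_of_parity`** (constant `Q̃`, a parity `P` fixing `flucCov(0)` and reversing every `∂ᵢΔ` ⟹ tadpole-free).
§5 (v1.1) THE LITERAL'S OWN PARITY SHAPE (twisted transpose, `trK K = sgnK K`, `trK S = −sgnK S`): **`trace_mul_eq_zero_of_twisted_transpose`**
   (`J·J = 1`, `Gᵀ = JGJ`, `Sᵀ = −JSJ ⟹ tr(GS) = 0`), **`fderiv_logZ_eq_zero_of_twisted_parity`** (the `Family`-level `htad` from that data; d1-formalise-ref I-d1ref28-2:
   an `htad` discharge for the literal must exhibit the `Family`, `hconst` and this parity — the torus identification is W-4).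
Provenance: β sub-cell, unit beta-an2 gen 24 (prover-b2b-balaban-beta-an2-g24-0), 2026-08-20; v1.1 (same gen): + §5, earlier declarations byte-identical.  NOT (SDF), NOT D1, NOT `BetaPertH`, NOT continuum, NOT Clay.
-/

noncomputable section

open Matrix Topology Filter
open scoped Matrix.Norms.Operator

open Literature.MathematicalPhysics.QuantumFieldTheory.Balaban1983to89.Beta (Family ConstrainedGaussian)
open Literature.MathematicalPhysics.QuantumFieldTheory.Balaban1983to89.Beta.LogDetHessian
open Literature.MathematicalPhysics.QuantumFieldTheory.Balaban1983to89.Beta.Composition (kkt)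
open Literature.MathematicalPhysics.QuantumFieldTheory.Balaban1983to89.Beta.CompositionSingular (flucCov minOp minOpL effForm
  kktInv_eq_fromBlocks minOpL_eq_transpose)

namespace Summit.QuantumFields.BalabanUV.Beta.LogZFirstJet

/-! ## §1 The first variation of `log det` along a matrix field -/

section MatrixCalculus

variable {p : Type*} [Fintype p] [DecidableEq p] {E : Type*} [NormedAddCommGroup E] [NormedSpace ℝ E]

/-- [folklore] **First variation of `log det`** along a matrix-valued map differentiable at a nonsingular point:
`D(log det K)(x₀)[u] = tr(K₀⁻¹ · DK(x₀)[u])`. -/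
theorem fderiv_log_det_apply {K : E → Matrix p p ℝ} {x₀ : E} (hK : DifferentiableAt ℝ K x₀) (h0 : IsUnit (K x₀).det)
    (u : E) : fderiv ℝ (fun x => Real.log (K x).det) x₀ u = ((K x₀)⁻¹ * fderiv ℝ K x₀ u).trace := by
  have h : HasFDerivAt (fun x => Real.log (K x).det) ((trMul (K x₀)⁻¹).comp (fderiv ℝ K x₀)) x₀ :=
    (hasFDerivAt_log_det (K x₀) h0).comp x₀ hK.hasFDerivAt
  rw [h.fderiv]
  rfl

/-- [folklore] **First variation of `log det`, entrywise data** (no matrix norm in the statement): every entry of `K` of class `C¹` at `x₀` and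
`det K(x₀) ≠ 0` ⟹ `D(log det K)(x₀)[u] = tr(K₀⁻¹ · ∂_uK)` with `∂_uK` formed entry by entry. -/
theorem fderiv_log_det_entrywise {K : E → Matrix p p ℝ} {x₀ : E} (hK : ∀ i j, ContDiffAt ℝ 1 (fun x => K x i j) x₀)
    (h0 : (K x₀).det ≠ 0) (u : E) :
    fderiv ℝ (fun x => Real.log (K x).det) x₀ u =
      ((K x₀)⁻¹ * Matrix.of (fun i j => fderiv ℝ (fun x => K x i j) x₀ u)).trace := by
  have hKd : DifferentiableAt ℝ K x₀ := (contDiffAt_matrix hK).differentiableAt one_ne_zero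
  have e1 : Matrix.of (fun i j => fderiv ℝ (fun x => K x i j) x₀ u) = fderiv ℝ K x₀ u := by
    ext i j; rw [Matrix.of_apply]; exact fderiv_apply_entry hKd i j u
  rw [e1]
  exact fderiv_log_det_apply hKd (isUnit_iff_ne_zero.2 h0) u

end MatrixCalculus

/-! ## §2 The first jet of `Family.logZ` -/

section FamilyJet

variable {ι : Type*} [Fintype ι] [DecidableEq ι] {n m : ℕ}

omit [DecidableEq ι] in
/-- [folklore] **THE FIRST JET OF `log Z` ALONG ANY DIRECTION**: for a background family with entries of `Q̃(·)`, `Δ(·)` of class `C¹` at `0` and nonsingular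
bordered matrix `K₀`, `D(F.logZ)(0)[u] = −½ · tr(K₀⁻¹ · ∂_uK)` (`∂_uK` entry by entry) — one derivative below `LogDetHessian.Family.polarization_eq_trace`. -/
theorem fderiv_logZ_apply (F : Family ι n m)
    (hQ : ∀ a b, ContDiffAt ℝ 1 (fun B => (F B).Q a b) 0) (hΔ : ∀ a b, ContDiffAt ℝ 1 (fun B => (F B).Δ a b) 0)
    (hdet : (F 0).kkt.det ≠ 0) (u : ι → ℝ) :
    fderiv ℝ F.logZ 0 u =
      -(1 / 2 : ℝ) * ((F 0).kkt⁻¹ * Matrix.of (fun a b => fderiv ℝ (fun B => (F B).kkt a b) 0 u)).trace := by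
  have hK := Family.contDiffAt_kkt_apply F hQ hΔ
  have hg : ContDiffAt ℝ 1 (fun B : ι → ℝ => Real.log (F B).kkt.det) 0 := (Family.contDiffAt_det_kkt F hQ hΔ).log hdet
  have hEq : F.logZ = fun B => ((n : ℝ) - m) / 2 * Real.log (2 * Real.pi) - (1 / 2 : ℝ) * Real.log (F B).kkt.det := by
    funext B
    simp only [Family.logZ, ConstrainedGaussian.logZ, Real.log_abs]
  rw [hEq, fderiv_const_sub, fderiv_const_mul (hg.differentiableAt one_ne_zero)]
  simp only [_root_.neg_apply, FunLike.coe_smul, Pi.smul_apply, smul_eq_mul]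
  rw [fderiv_log_det_entrywise hK hdet u]
  ring

/-- [folklore] **THE FIRST JET ON A COORDINATE VECTOR**: `∂ᵢ(F.logZ)(0) = −½ · tr(K₀⁻¹ · ∂ᵢK)` with `∂ᵢK = F.dK i` of `LogDetHessian`. -/
theorem fderiv_logZ_single (F : Family ι n m)
    (hQ : ∀ a b, ContDiffAt ℝ 1 (fun B => (F B).Q a b) 0) (hΔ : ∀ a b, ContDiffAt ℝ 1 (fun B => (F B).Δ a b) 0)
    (hdet : (F 0).kkt.det ≠ 0) (i : ι) :
    fderiv ℝ F.logZ 0 (Pi.single i 1) = -(1 / 2 : ℝ) * ((F 0).kkt⁻¹ * F.dK i).trace := by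
  rw [fderiv_logZ_apply F hQ hΔ hdet]
  rfl

omit [Fintype ι] [DecidableEq ι] in
/-- [folklore] The bordered matrix of the `Beta.OneLoop` model IS `Composition.kkt Δ Q` (same blocks). -/
theorem kkt_eq_kkt (Z : ConstrainedGaussian n m) : Z.kkt = kkt Z.Δ Z.Q := rfl

/-- [folklore] **BLOCK FORM OF THE FIRST JET**: with `𝒢 = flucCov`, `ℋ = minOp`, `ℋ♭ = minOpL` of the base-point datum `(Δ(0), Q̃(0))`,
`∂ᵢ(F.logZ)(0) = −½·tr(𝒢·∂ᵢΔ) − ½·tr(ℋ·∂ᵢQ̃) − ½·tr(ℋ♭·∂ᵢQ̃ᵀ)` — fluctuation-covariance TADPOLE of the first vertex plus the constraint-variation terms. -/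
theorem fderiv_logZ_single_blocks (F : Family ι n m)
    (hQ : ∀ a b, ContDiffAt ℝ 1 (fun B => (F B).Q a b) 0) (hΔ : ∀ a b, ContDiffAt ℝ 1 (fun B => (F B).Δ a b) 0)
    (hdet : (F 0).kkt.det ≠ 0) (i : ι) :
    fderiv ℝ F.logZ 0 (Pi.single i 1) =
      -(1 / 2 : ℝ) * (flucCov (F 0).Δ (F 0).Q * F.dΔ i).trace
        - (1 / 2 : ℝ) * (minOp (F 0).Δ (F 0).Q * F.dQ i).trace
        - (1 / 2 : ℝ) * (minOpL (F 0).Δ (F 0).Q * (F.dQ i)ᵀ).trace := by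
  rw [fderiv_logZ_single F hQ hΔ hdet i, kkt_eq_kkt, kktInv_eq_fromBlocks, Family.dK_eq_fromBlocks,
    trace_blockInv_mul_variation]
  ring

/-- [folklore] **BLOCK FORM, SYMMETRIC FINE FORM**: if `Δ(0)` is symmetric then `ℋ♭ = ℋᵀ` and the two constraint terms coincide:
`∂ᵢ(F.logZ)(0) = −½·tr(𝒢·∂ᵢΔ) − tr(ℋ·∂ᵢQ̃)`. -/
theorem fderiv_logZ_single_blocks_of_symm (F : Family ι n m)
    (hQ : ∀ a b, ContDiffAt ℝ 1 (fun B => (F B).Q a b) 0) (hΔ : ∀ a b, ContDiffAt ℝ 1 (fun B => (F B).Δ a b) 0)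
    (hdet : (F 0).kkt.det ≠ 0) (hsymm : (F 0).Δ.IsSymm) (i : ι) :
    fderiv ℝ F.logZ 0 (Pi.single i 1) =
      -(1 / 2 : ℝ) * (flucCov (F 0).Δ (F 0).Q * F.dΔ i).trace - (minOp (F 0).Δ (F 0).Q * F.dQ i).trace := by
  rw [fderiv_logZ_single_blocks F hQ hΔ hdet i, (minOpL_eq_transpose (F 0).Δ (F 0).Q hsymm.eq).1,
    ← Matrix.transpose_mul, Matrix.trace_transpose, Matrix.trace_mul_comm (F.dQ i)]
  ring

end FamilyJet

/-! ## §3 Tadpole-freeness as a finite list of trace identities -/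

section TadpoleFree

variable {ι : Type*} [Fintype ι] [DecidableEq ι] {n m : ℕ}

omit [Fintype ι] in
/-- [folklore] A continuous linear functional on `ι → ℝ` vanishes iff it vanishes on every coordinate vector `eᵢ`. -/
theorem clm_eq_zero_iff_single [Finite ι] (ℓ : (ι → ℝ) →L[ℝ] ℝ) : ℓ = 0 ↔ ∀ i, ℓ (Pi.single i 1) = 0 := by
  constructor
  · intro h i; rw [h]; rfl
  · intro h
    have : (ℓ : (ι → ℝ) →ₗ[ℝ] ℝ) = 0 := by
      refine LinearMap.pi_ext' fun i => LinearMap.ext_ring ?_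
      simpa using h i
    exact ContinuousLinearMap.coe_injective this

/-- [folklore] **TADPOLE-FREENESS ⟺ `n`-MANY TRACE IDENTITIES**: `fderiv ℝ F.logZ 0 = 0 ↔ ∀ i, tr(K₀⁻¹ · ∂ᵢK) = 0`. -/
theorem fderiv_logZ_eq_zero_iff (F : Family ι n m)
    (hQ : ∀ a b, ContDiffAt ℝ 1 (fun B => (F B).Q a b) 0) (hΔ : ∀ a b, ContDiffAt ℝ 1 (fun B => (F B).Δ a b) 0)
    (hdet : (F 0).kkt.det ≠ 0) :
    fderiv ℝ F.logZ 0 = 0 ↔ ∀ i, ((F 0).kkt⁻¹ * F.dK i).trace = 0 := by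
  rw [clm_eq_zero_iff_single]
  refine forall_congr' fun i => ?_
  rw [fderiv_logZ_single F hQ hΔ hdet i]
  constructor
  · intro h; linarith
  · intro h; rw [h]; ring

omit [Fintype ι] in
/-- [folklore] A background-independent constraint has vanishing first variations: `Q̃(B) = Q̃(0)` near `0` ⟹ `F.dQ i = 0`. -/
theorem dQ_eq_zero_of_constQ (F : Family ι n m) (hconst : ∀ᶠ B in 𝓝 (0 : ι → ℝ), (F B).Q = (F 0).Q) (i : ι) :
    F.dQ i = 0 := by
  ext a b
  simp only [Family.dQ, Matrix.of_apply, Matrix.zero_apply]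
  have hc : (fun B => (F B).Q a b) =ᶠ[𝓝 (0 : ι → ℝ)] fun _ => (F 0).Q a b :=
    hconst.mono fun B hB => by simp only [hB]
  rw [hc.fderiv_eq]
  simp

/-- [folklore] **TADPOLE-FREENESS FOR A BACKGROUND-INDEPENDENT CONSTRAINT ⟺ EVERY SINGLE-INSERTION CONTRACTION VANISHES**: if `Q̃(B) = Q̃(0)` near `0`,
then `fderiv ℝ F.logZ 0 = 0 ↔ ∀ i, tr(flucCov(Δ(0), Q̃(0)) · ∂ᵢΔ) = 0` — the contraction `Σ_{v,w} 𝒢(v,w)·∂ᵢΔ(w,v)` of the first (cubic) vertex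
against the fluctuation covariance, for every external leg `i`.  (This is the matrix-level shape of the literal's `ExpKernelCalculus.tadpole ≡ 0`
statements; the identification on the torus is W-4.) -/
theorem fderiv_logZ_eq_zero_iff_of_constQ (F : Family ι n m)
    (hQ : ∀ a b, ContDiffAt ℝ 1 (fun B => (F B).Q a b) 0) (hΔ : ∀ a b, ContDiffAt ℝ 1 (fun B => (F B).Δ a b) 0)
    (hdet : (F 0).kkt.det ≠ 0) (hconst : ∀ᶠ B in 𝓝 (0 : ι → ℝ), (F B).Q = (F 0).Q) :
    fderiv ℝ F.logZ 0 = 0 ↔ ∀ i, (flucCov (F 0).Δ (F 0).Q * F.dΔ i).trace = 0 := by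
  rw [clm_eq_zero_iff_single]
  refine forall_congr' fun i => ?_
  rw [fderiv_logZ_single_blocks F hQ hΔ hdet i, dQ_eq_zero_of_constQ F hconst i]
  simp only [Matrix.transpose_zero, Matrix.mul_zero, Matrix.trace_zero, mul_zero, sub_zero]
  constructor
  · intro h; linarith
  · intro h; rw [h]; ring

end TadpoleFree

/-! ## §4 The parity mechanism in matrix currency -/

section Parity

variable {p : Type*} [Fintype p]

/-- [folklore] **PARITY KILLS THE TADPOLE**: if conjugation by `P` fixes `G` (`P·G·P = G`) and reverses `S` (`P·S·P = −S`), then `tr(G·S) = 0`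
(`tr(GS) = tr(PGP·S) = tr(G·PSP) = −tr(GS)`; no involution hypothesis is needed).  This is the matrix shape of the literal's J-signed parity theorems
(`BubbleParity.trK_coDressKBmAt_KInvStep`, `SpineRecursiveParity.trK_SrecAt`, `KernelWardRelativeEnd.tadpole_eq_zero_of_parity`). -/
theorem trace_mul_eq_zero_of_parity (P G S : Matrix p p ℝ) (hG : P * G * P = G) (hS : P * S * P = -S) :
    (G * S).trace = 0 := by
  have h2 : (G * S).trace = (G * (P * S * P)).trace := by
    calc (G * S).trace = (P * G * P * S).trace := by rw [hG]
      _ = (P * (G * P * S)).trace := by simp only [Matrix.mul_assoc]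
      _ = ((G * P * S) * P).trace := Matrix.trace_mul_comm _ _
      _ = (G * (P * S * P)).trace := by simp only [Matrix.mul_assoc]
  rw [hS, Matrix.mul_neg, Matrix.trace_neg] at h2
  linarith

end Parity

section ParityFamily

variable {ι : Type*} [Fintype ι] [DecidableEq ι] {n m : ℕ}

/-- [folklore] **TADPOLE-FREE BY PARITY** (the functional-level statement the K-U2∕K-U2b∕K-U2c∕K-U2e ENDs consume, from matrix parity data): a
background-independent constraint, `C¹` entries, nonsingular `K₀`, and a matrix `P` with `P·flucCov(0)·P = flucCov(0)` and `P·∂ᵢΔ·P = −∂ᵢΔ` for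
every `i` ⟹ `fderiv ℝ F.logZ 0 = 0`. -/
theorem fderiv_logZ_eq_zero_of_parity (F : Family ι n m)
    (hQ : ∀ a b, ContDiffAt ℝ 1 (fun B => (F B).Q a b) 0) (hΔ : ∀ a b, ContDiffAt ℝ 1 (fun B => (F B).Δ a b) 0)
    (hdet : (F 0).kkt.det ≠ 0) (hconst : ∀ᶠ B in 𝓝 (0 : ι → ℝ), (F B).Q = (F 0).Q)
    (P : Matrix (Fin n) (Fin n) ℝ) (hG : P * flucCov (F 0).Δ (F 0).Q * P = flucCov (F 0).Δ (F 0).Q)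
    (hS : ∀ i, P * F.dΔ i * P = -F.dΔ i) :
    fderiv ℝ F.logZ 0 = 0 :=
  (fderiv_logZ_eq_zero_iff_of_constQ F hQ hΔ hdet hconst).2 fun i => trace_mul_eq_zero_of_parity P _ _ hG (hS i)

end ParityFamily

/-! ## §5 (v1.1) The literal's parity shape: TWISTED-TRANSPOSE symmetry `Kᵀ = JKJ`, `Sᵀ = −JSJ` -/

section TwistedParity

variable {p : Type*} [Fintype p] [DecidableEq p]

/-- [folklore] **TWISTED-TRANSPOSE PARITY KILLS THE TADPOLE** — the exact matrix shape of the literal's `trK K = sgnK K`, `trK S = −sgnK S`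
(`TameKernelCalculus.trK` = transpose, `BorderedHessianSymmetry.sgnK` = conjugation by the fibre sign `J = diag(sgnF)`): if `J·J = 1`, `Gᵀ = J·G·J` and
`Sᵀ = −(J·S·J)` then `tr(G·S) = 0` (`tr(GS) = tr((GS)ᵀ) = tr(SᵀGᵀ) = −tr(JSJ·JGJ) = −tr(J·SG·J) = −tr(SG) = −tr(GS)`). -/
theorem trace_mul_eq_zero_of_twisted_transpose (J G S : Matrix p p ℝ) (hJ : J * J = 1) (hG : Gᵀ = J * G * J)
    (hS : Sᵀ = -(J * S * J)) : (G * S).trace = 0 := by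
  have h1 : (G * S).trace = (Sᵀ * Gᵀ).trace := by rw [← Matrix.trace_transpose, Matrix.transpose_mul]
  have h2 : (Sᵀ * Gᵀ).trace = -(G * S).trace := by
    rw [hS, hG, Matrix.neg_mul, Matrix.trace_neg]
    have e : J * S * J * (J * G * J) = J * (S * G) * J := by
      calc J * S * J * (J * G * J) = J * S * (J * J) * G * J := by simp only [Matrix.mul_assoc]
        _ = J * (S * G) * J := by rw [hJ, Matrix.mul_one]; simp only [Matrix.mul_assoc]
    rw [e, Matrix.trace_mul_cycle, ← Matrix.mul_assoc, hJ, Matrix.one_mul, Matrix.trace_mul_comm]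
  linarith

end TwistedParity

section TwistedParityFamily

variable {ι : Type*} [Fintype ι] [DecidableEq ι] {n m : ℕ}

/-- [folklore] **TADPOLE-FREE BY TWISTED-TRANSPOSE PARITY** (the `Family`-level statement in the literal's own parity shape): background-independent `Q̃`,
`C¹` entries, nonsingular `K₀`, a sign matrix `J` (`J·J = 1`) with `flucCov(0)ᵀ = J·flucCov(0)·J` and `(∂ᵢΔ)ᵀ = −(J·∂ᵢΔ·J)` for every `i` ⟹ `fderiv ℝ F.logZ 0 = 0`.
(For the literal: `J = diag(sgnF)` on `Fib d`; the co-dressed step resolvents are `J`-twisted-symmetric — `BubbleParity.trK_coDressKBmAt_KInvStep` — and the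
first-vertex tables `J`-twisted-antisymmetric — `SpineRecursiveParity.trK_SrecAt`; the torus identification of `flucCov(0)` ∕ `∂ᵢΔ` with those kernels is W-4.) -/
theorem fderiv_logZ_eq_zero_of_twisted_parity (F : Family ι n m)
    (hQ : ∀ a b, ContDiffAt ℝ 1 (fun B => (F B).Q a b) 0) (hΔ : ∀ a b, ContDiffAt ℝ 1 (fun B => (F B).Δ a b) 0)
    (hdet : (F 0).kkt.det ≠ 0) (hconst : ∀ᶠ B in 𝓝 (0 : ι → ℝ), (F B).Q = (F 0).Q)
    (J : Matrix (Fin n) (Fin n) ℝ) (hJ : J * J = 1) (hG : (flucCov (F 0).Δ (F 0).Q)ᵀ = J * flucCov (F 0).Δ (F 0).Q * J)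
    (hS : ∀ i, (F.dΔ i)ᵀ = -(J * F.dΔ i * J)) :
    fderiv ℝ F.logZ 0 = 0 :=
  (fderiv_logZ_eq_zero_iff_of_constQ F hQ hΔ hdet hconst).2 fun i => trace_mul_eq_zero_of_twisted_transpose J _ _ hJ hG (hS i)

end TwistedParityFamily

end Summit.QuantumFields.BalabanUV.Beta.LogZFirstJet

end
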